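import Summits.MatrixMultiplication.MatrixMultiplication.Theses.NilpotentLieHosts

/-!
# Route NilpotentLieHosts — the assembly `Assembly` (item stmt-MatrixMultiplication-7730)

Route `MatrixMultiplication/NilpotentLieHosts`, item stmt-MatrixMultiplication-7730 (`Assembly`,
rank 1):

  `UnitriangularCostShape → NilpotentThresholdDesigns → MatrixMultiplication` (`ω(ℂ) = 2`).

This is, verbatim, the type of the route's kernel-checked deciding theorem
`Summit.MatrixMultiplication.MatrixMultiplication.Theses.NilpotentLieHosts.closes`; the proof below
replays the exponent bookkeeping against the literal route decl without depending on `closes`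
itself (so the file survives any later re-authoring of the deciding theorem's proof script), and
isolates the bookkeeping as an abstract lemma `omega_le_two_of_priced_designs` in which the host,
the triple product property and the separating polynomials are invisible: all that is used is

* COST at one dimension parameter `A` (`= D = d(d-1)/2`) with an index `b > 0` and a constant `C`:
  every design of budget `s` and volume `v = |X||Y||Z|` is priced `v^(ω/3) ≤ C·(s+1)^F`,
  `F := ((A - b)/2)·ω + b`;
* DESIGN: for every loss `δ > 0`, unboundedly many budgets `s` carry a design of volume
  `v ≥ s^((3/2)·A - δ)` (half dimension: `(3/2)·D = (3/4)·d(d-1)`).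

Bookkeeping (no analysis beyond `x ↦ x^g → ∞` for `g > 0`): `2 ≤ ω` is the tree's flattening bound
`omega_two_le`.  If `2 < ω`, feed the design half the loss `δ := b(ω-2)/(2ω) > 0`; the design
exponent times `ω/3` then exceeds `F` by exactly `g := b(ω-2)/3 > 0` (both carry `A·ω/2`), so a
design at a budget `s ≥ 1` gives `s^g · s^F = s^(g+F) ≤ v^(ω/3) ≤ C·(s+1)^F ≤ max C 1 · max 1 2^F · s^F`,
i.e. `s^g ≤ max C 1 · max 1 2^F` — impossible for the unboundedly large budgets the design half
supplies (`tendsto_rpow_atTop`).  Hence `ω ≤ 2`, so `ω(ℂ) = 2`, which is `MatrixMultiplication`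
(`MatrixMultiplication_iff`).  The Heisenberg branch (`HeisenbergBranch`, d = 3: `A = 3`, `b = 1`,
cost exponent `ω + 1`, threshold `9/2`) is the same lemma at other parameters.

References: M. Bläser, *Fast Matrix Multiplication*, Theory of Computing Graduate Surveys 5 (2013),
Def. 5.1 / §5 (`ω`, `ω ≥ 2`); J. Blasiak, H. Cohn, J. A. Grochow, K. Pratt, C. Umans, *Finite matrix
multiplication algorithms from infinite groups* (arXiv:2410.14905, 2024), Thm 2.2 / Rem 2.4 (the
shape of the cost inequality).  Nothing about Lie hosts is proved here: the two hypotheses are the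
route's cruxes, taken as stated.
-/

-- the tree's namespace `Summit.MatrixMultiplication.MatrixMultiplication.…` repeats a component by design
set_option linter.dupNamespace false

namespace Summit.MatrixMultiplication.MatrixMultiplication.Theorems

open Summit.MatrixMultiplication.MatrixMultiplication.Theses.NilpotentLieHosts
open Literature.Computability.AlgebraicComplexity

/-- Absorbing the `+1` of a budget: for real `s ≥ 1` and any real exponent `F`,
`(s+1)^F ≤ max 1 2^F · s^F` (`F ≥ 0`: `(s+1)^F ≤ (2s)^F = 2^F s^F`; `F ≤ 0`: `(s+1)^F ≤ s^F`).
[folklore] -/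
theorem add_one_rpow_le_max_mul_rpow {s : ℝ} (F : ℝ) (hs : 1 ≤ s) :
    (s + 1) ^ F ≤ max 1 ((2 : ℝ) ^ F) * s ^ F := by
  have hs0 : 0 < s := one_pos.trans_le hs
  have hsF : 0 ≤ s ^ F := Real.rpow_nonneg hs0.le F
  rcases le_or_gt 0 F with hF | hF
  · calc (s + 1) ^ F ≤ (2 * s) ^ F := Real.rpow_le_rpow (by positivity) (by linarith) hF
      _ = (2 : ℝ) ^ F * s ^ F := Real.mul_rpow zero_le_two hs0.le
      _ ≤ max 1 ((2 : ℝ) ^ F) * s ^ F := mul_le_mul_of_nonneg_right (le_max_right _ _) hsF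
  · calc (s + 1) ^ F ≤ s ^ F := Real.rpow_le_rpow_of_nonpos hs0 (by linarith) hF.le
      _ = 1 * s ^ F := (one_mul _).symm
      _ ≤ max 1 ((2 : ℝ) ^ F) * s ^ F := mul_le_mul_of_nonneg_right (le_max_left _ _) hsF

/-- **Exponent bookkeeping of route NilpotentLieHosts, abstract form.**  Fix a dimension parameter
`A`, an index `b > 0` and a constant `C`.  Suppose that for every loss `δ > 0` there are unboundedly
many budgets `s : ℕ` carrying a "priced design": a volume `v ≥ 0` with `s^((3/2)·A - δ) ≤ v`
(DESIGN, half dimension) and `v^(ω(ℂ)/3) ≤ C·(s+1)^(((A-b)/2)·ω(ℂ) + b)` (COST, index `b`).  Then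
`ω(ℂ) ≤ 2`.  Proof: if `2 < ω`, the loss `δ := b(ω-2)/(2ω)` leaves a gap
`s^(b(ω-2)/3) ≤ max C 1 · max 1 2^F`, absurd as `s → ∞` (`tendsto_rpow_atTop`); `2 ≤ ω`
(`omega_two_le`) is used only to make `δ > 0`. [folklore] -/
theorem omega_le_two_of_priced_designs (A b C : ℝ) (hb : 0 < b)
    (h : ∀ δ : ℝ, 0 < δ → ∀ s₀ : ℕ, ∃ s : ℕ, s₀ ≤ s ∧ ∃ v : ℝ, 0 ≤ v ∧
      (s : ℝ) ^ (3 / 2 * A - δ) ≤ v ∧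
      v ^ (omega ℂ / 3) ≤ C * ((s : ℝ) + 1) ^ ((A - b) / 2 * omega ℂ + b)) :
    omega ℂ ≤ 2 := by
  have hw2 : 2 ≤ omega ℂ := omega_two_le ℂ
  refine not_lt.1 fun hlt => ?_
  set w : ℝ := omega ℂ with hwdef
  have hwpos : 0 < w := lt_of_lt_of_le two_pos hw2
  have hw2' : 0 < w - 2 := sub_pos.2 hlt
  -- the loss `δ = b(w-2)/(2w)` fed to the design half, the cost exponent `F`, the gap `g`
  have hδ : 0 < b * (w - 2) / (2 * w) := div_pos (mul_pos hb hw2') (mul_pos two_pos hwpos)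
  set F : ℝ := (A - b) / 2 * w + b with hFdef
  set g : ℝ := b * (w - 2) / 3 with hgdef
  have hg : 0 < g := div_pos (mul_pos hb hw2') three_pos
  have hcancel : b * (w - 2) / (2 * w) * (w / 3) = b * (w - 2) / 6 := by
    field_simp
    ring
  have hexp : (3 / 2 * A - b * (w - 2) / (2 * w)) * (w / 3) = g + F := by
    rw [sub_mul, hcancel, hgdef, hFdef]
    ring
  -- constants: `C' = max C 1` and `K = max 1 2^F`
  set C' : ℝ := max C 1 with hC'def
  set K : ℝ := max 1 ((2 : ℝ) ^ F) with hKdef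
  have hC'0 : 0 ≤ C' := zero_le_one.trans (le_max_right _ _)
  -- `x ↦ x^g` is unbounded: beyond `M` it exceeds `C'·K + 1`
  obtain ⟨M, hM⟩ := Filter.tendsto_atTop_atTop.1 (tendsto_rpow_atTop hg) (C' * K + 1)
  -- a priced design at a budget `s ≥ max 1 ⌈M⌉₊`
  obtain ⟨s, hs, v, hv0, hV, hcost⟩ := h (b * (w - 2) / (2 * w)) hδ (max 1 (Nat.ceil M))
  have hs1 : 1 ≤ s := (le_max_left _ _).trans hs
  have hsM : M ≤ (s : ℝ) :=
    (Nat.le_ceil M).trans (by exact_mod_cast (le_max_right 1 (Nat.ceil M)).trans hs)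
  have hsR1 : (1 : ℝ) ≤ s := by exact_mod_cast hs1
  have hsR0 : (0 : ℝ) < s := one_pos.trans_le hsR1
  have hsF : (0 : ℝ) < (s : ℝ) ^ F := Real.rpow_pos_of_pos hsR0 F
  -- real bookkeeping: `s^g · s^F ≤ v^(w/3) ≤ C (s+1)^F ≤ C'·K·s^F`
  have h1 : (s : ℝ) ^ g * (s : ℝ) ^ F ≤ v ^ (w / 3) := by
    rw [← Real.rpow_add hsR0, ← hexp, Real.rpow_mul hsR0.le]
    exact Real.rpow_le_rpow (Real.rpow_nonneg hsR0.le _) hV (div_nonneg hwpos.le three_pos.le)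
  have h2 : C * ((s : ℝ) + 1) ^ F ≤ C' * (K * (s : ℝ) ^ F) :=
    calc C * ((s : ℝ) + 1) ^ F ≤ C' * ((s : ℝ) + 1) ^ F :=
          mul_le_mul_of_nonneg_right (le_max_left _ _) (Real.rpow_nonneg (by positivity) F)
      _ ≤ C' * (K * (s : ℝ) ^ F) :=
          mul_le_mul_of_nonneg_left (add_one_rpow_le_max_mul_rpow F hsR1) hC'0
  have h4 : (s : ℝ) ^ g * (s : ℝ) ^ F ≤ C' * K * (s : ℝ) ^ F := by
    rw [mul_assoc]
    exact h1.trans (hcost.trans h2)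
  have h5 : (s : ℝ) ^ g ≤ C' * K := le_of_mul_le_mul_right h4 hsF
  have h6 : C' * K + 1 ≤ (s : ℝ) ^ g := hM (s : ℝ) hsM
  linarith

/-- **COST ∧ DESIGN at one dimension decide `ω(ℂ) ≤ 2`** — the per-dimension glue of route
NilpotentLieHosts: a cost shape `(|X||Y||Z|)^(ω/3) ≤ C (s+1)^(((D-b)/2)·ω + b)` with `b > 0`,
`D = d(d-1)/2`, for all TPP triples in `U_d(ℤ)` with weighted-degree-`≤ s` separating polynomials,
together with such designs of volume `|X||Y||Z| ≥ s^((3/4)d(d-1) - δ)` for every `δ > 0` at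
unboundedly many budgets `s`, gives `ω(ℂ) ≤ 2` (instance of `omega_le_two_of_priced_designs` at
`A = d(d-1)/2`, `v = |X||Y||Z|`). [folklore] -/
theorem omega_le_two_of_costShape_of_thresholdDesigns (d : ℕ) (b C : ℝ) (hb : 0 < b)
    (hC : ∀ (s : ℕ) (X Y Z : Finset (Matrix.SpecialLinearGroup (Fin d) ℤ)),
      (∀ g ∈ X ∪ Y ∪ Z, ∀ i j : Fin d, j ≤ i →
        (g : Matrix (Fin d) (Fin d) ℤ) i j = if i = j then 1 else 0) →
      (∀ x ∈ X, ∀ x' ∈ X, ∀ y ∈ Y, ∀ y' ∈ Y, ∀ z ∈ Z, ∀ z' ∈ Z,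
        x * y⁻¹ * y' * z⁻¹ = x' * z'⁻¹ → x = x' ∧ y = y' ∧ z = z') →
      (∀ x₀ ∈ X, ∀ z₀ ∈ Z, ∃ p : MvPolynomial (Fin d × Fin d) ℂ,
        MvPolynomial.weightedTotalDegree (fun ij : Fin d × Fin d => (ij.2 : ℕ) - ij.1) p ≤ s ∧
        ∀ x ∈ X, ∀ y ∈ Y, ∀ y' ∈ Y, ∀ z ∈ Z, MvPolynomial.eval (fun ij : Fin d × Fin d =>
          (((x * y⁻¹ * y' * z⁻¹ : Matrix.SpecialLinearGroup (Fin d) ℤ) :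
            Matrix (Fin d) (Fin d) ℤ) ij.1 ij.2 : ℂ)) p =
          if x = x₀ ∧ y = y' ∧ z = z₀ then 1 else 0) →
      ((X.card : ℝ) * Y.card * Z.card) ^ (omega ℂ / 3) ≤
        C * ((s : ℝ) + 1) ^ (((d : ℝ) * (d - 1) / 2 - b) / 2 * omega ℂ + b))
    (hD : ∀ δ : ℝ, 0 < δ → ∀ s₀ : ℕ, ∃ s : ℕ, s₀ ≤ s ∧
      ∃ X Y Z : Finset (Matrix.SpecialLinearGroup (Fin d) ℤ),
      (∀ g ∈ X ∪ Y ∪ Z, ∀ i j : Fin d, j ≤ i →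
        (g : Matrix (Fin d) (Fin d) ℤ) i j = if i = j then 1 else 0) ∧
      (∀ x ∈ X, ∀ x' ∈ X, ∀ y ∈ Y, ∀ y' ∈ Y, ∀ z ∈ Z, ∀ z' ∈ Z,
        x * y⁻¹ * y' * z⁻¹ = x' * z'⁻¹ → x = x' ∧ y = y' ∧ z = z') ∧
      (∀ x₀ ∈ X, ∀ z₀ ∈ Z, ∃ p : MvPolynomial (Fin d × Fin d) ℂ,
        MvPolynomial.weightedTotalDegree (fun ij : Fin d × Fin d => (ij.2 : ℕ) - ij.1) p ≤ s ∧
        ∀ x ∈ X, ∀ y ∈ Y, ∀ y' ∈ Y, ∀ z ∈ Z, MvPolynomial.eval (fun ij : Fin d × Fin d =>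
          (((x * y⁻¹ * y' * z⁻¹ : Matrix.SpecialLinearGroup (Fin d) ℤ) :
            Matrix (Fin d) (Fin d) ℤ) ij.1 ij.2 : ℂ)) p =
          if x = x₀ ∧ y = y' ∧ z = z₀ then 1 else 0) ∧
      (s : ℝ) ^ ((3 : ℝ) / 4 * d * (d - 1) - δ) ≤ (X.card : ℝ) * Y.card * Z.card) :
    omega ℂ ≤ 2 := by
  refine omega_le_two_of_priced_designs ((d : ℝ) * (d - 1) / 2) b C hb fun δ hδ s₀ => ?_
  obtain ⟨s, hs, X, Y, Z, hU, hT, hS, hV⟩ := hD δ hδ s₀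
  refine ⟨s, hs, (X.card : ℝ) * Y.card * Z.card, by positivity, ?_, hC s X Y Z hU hT hS⟩
  have hA : (3 : ℝ) / 2 * ((d : ℝ) * (d - 1) / 2) - δ = (3 : ℝ) / 4 * d * (d - 1) - δ := by ring
  rw [hA]
  exact hV

/-- **Assembly of route NilpotentLieHosts** (item stmt-MatrixMultiplication-7730), exact signature
`UnitriangularCostShape → NilpotentThresholdDesigns → MatrixMultiplication`: take the design
dimension `d ≥ 3` of `NilpotentThresholdDesigns` and the cost shape `b > 0`, `C` of
`UnitriangularCostShape` at that `d`; `omega_le_two_of_costShape_of_thresholdDesigns` gives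
`ω(ℂ) ≤ 2`, the flattening bound `omega_two_le` gives `2 ≤ ω(ℂ)`, and `ω(ℂ) = 2` is
`MatrixMultiplication` (`MatrixMultiplication_iff`).  The statement is literally the type of the
route's deciding theorem `Theses.NilpotentLieHosts.closes`; the proof here is self-contained.
[cite: Blaser2013, Def. 5.1] -/
theorem nilpotentLieHosts_assembly_proof :
    Summit.MatrixMultiplication.MatrixMultiplication.Theses.NilpotentLieHosts.Assembly := by
  unfold Summit.MatrixMultiplication.MatrixMultiplication.Theses.NilpotentLieHosts.Assembly
  intro hCost hDesign
  rw [_root_.MatrixMultiplication_iff]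
  refine le_antisymm ?_ (omega_two_le ℂ)
  obtain ⟨d, hd3, hD⟩ := hDesign
  obtain ⟨b, hb, C, hC⟩ := hCost d hd3
  exact omega_le_two_of_costShape_of_thresholdDesigns d b C hb hC hD

end Summit.MatrixMultiplication.MatrixMultiplication.Theorems
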